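import Summits.HodgeConjecture.HodgeConjecture.Theorems.MarkmanPartnerTransportPicardThreeK3SquaresAlgebraicLocusSpread
import Summits.HodgeConjecture.HodgeConjecture.Theorems.MarkmanPartnerTransportPicardThreeK3SquaresCmAnchorSpreadDefs

/-!
# Route MarkmanPartnerTransport · crux `PicardThreeK3Squares` (stmt-HodgeConjecture-19652) —
# registered stub `stub_algebraicLocusClosed` of line `cm-anchor-spread`, discharged BY NAME

The registered skeleton of the crux (sha `39ba70b5986d…`, line `cm-anchor-spread` r2) lists the stub
`stub_algebraicLocusClosed : AlgebraicLocusClosed`. Its statement — spread of fibrewise algebraicity of a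
global class from a non-empty Euclidean-open subset of a smooth quasi-projective base with connected
`B(ℂ)` to every fibre — is the tree THEOREM
`MarkmanPartnerTransport.AlgebraicLocusSpread.algebraicLocusClosed` (Charles–Schnell Prop. 11.3.11 /
Voisin II §7.3.2 + Baire, proved fact-free by seat hodge-nonav-19652-p1 gen 7), and carries its registered
name in `MarkmanPartnerTransport.CmAnchorSpread.AlgebraicLocusClosed` (`…CmAnchorSpreadDefs`). This file
is the one-line identification:

* `CmAnchorSpread.stub_algebraicLocusClosed : AlgebraicLocusClosed`.

Honesty box. This closes ONE registered stub (F3) of a line whose load-bearing stub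
`stub_rmSpreadFamilyAnchored` was found false in substance by its lead (gen 2; route owner hodge-nonav-p1
gen 25: line `cm-anchor-spread` dead in substance, crux NOT refuted); the other four open stubs are named
facts (`Buskin2019_hodgeIsometry_algebraic`, `Huybrechts_K3_marking_exists`, `BlochSemiregularSpread 4 2`)
and the plan-only rung `RungRank13`. Nothing here proves the crux `PicardThreeK3Squares` or any instance of
the Hodge conjecture. No definition, no sorry, no named fact. Prover seat leafhand-hodge-markmanpartnertran-1
(gen 0), `--supports stmt-HodgeConjecture-19652`.
-/

set_option linter.dupNamespace false

noncomputable section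

namespace Summit.HodgeConjecture.HodgeConjecture.Theorems.MarkmanPartnerTransport.CmAnchorSpread

/-- **Registered stub F3 `stub_algebraicLocusClosed` of line `cm-anchor-spread` (crux
`PicardThreeK3Squares`, stmt-HodgeConjecture-19652), by name**: for a smooth projective family
`g : 𝒳 → B` (quasi-projective total space; smooth quasi-projective base with `B(ℂ)` connected) and a global
class `W ∈ H²ᵖ(𝒳(ℂ); ℂ)`, algebraicity of `W|_{𝒳_b}` on a non-empty Euclidean-open `U ⊆ B(ℂ)` implies
algebraicity at every `b ∈ B(ℂ)`. Proof: the tree theorem `AlgebraicLocusSpread.algebraicLocusClosed`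
(the algebraicity locus is a countable union of Zariski-closed subsets of the irreducible `B`; Baire).
[cite: CharlesSchnell2014Notes, Prop. 11.3.11 (proof)] [cite: VoisinHodgeII2003, §3.3.1 and §7.3.2] -/
theorem stub_algebraicLocusClosed : AlgebraicLocusClosed :=
  AlgebraicLocusSpread.algebraicLocusClosed

end Summit.HodgeConjecture.HodgeConjecture.Theorems.MarkmanPartnerTransport.CmAnchorSpread

end
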